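import Literature.AnabelianGeometry.SemiGraphs.PSCUnrTransportProofs
import HarnessLib

/-!
# [CombGC] Theorem 1.6 (iii), necessity: "verticially filtration-preserving ⟹ group-theoretically verticial", assembled formally

Mochizuki, *A combinatorial version of the Grothendieck conjecture*, Tohoku Math. J. **59** (2007)
[CombGC], Theorem 1.6 (iii) (author's ms p. 13): "Assume that `G`, `H` are sturdy. Then `β` is
verticially filtration-preserving if and only if it is group-theoretically verticial"; its proof as
amended by Mochizuki, *Inter-universal Teichmüller theory I*, Remark 1.2.3 (vii) (kurims p. 43):
"Sufficiency is immediate [`CoveringsErrataVerticial`, abc-iut-L5-t6]. On the other hand, necessity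
follows formally from the characterization of unramified verticial subgroups given in Remark 1.4.3
[= [IUTchI] Rmk. 1.2.3 (iv): "the set of vertices of `G` may be characterized as the set of
[nontrivial!] quotients `M^unr-vert_G ↠ M^unr_G[v] ⊗ F_l`", these being "the maximal quotients …
among those elementary abelian quotients of `M^unr_G` that correspond to verticially purely totally
ramified coverings", and "in order to characterize the unramified verticial subgroups of `Π^unr_G`,
it suffices — by considering stabilizers of vertices of … finite étale `Π^unr_G`-coverings of `G` —
to give a functorial characterization of the set of vertices of `G` [i.e., a characterization which
may also be applied to finite étale `Π^unr_G`-coverings of `G`]"] and the characterization of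
verticially purely totally ramified finite étale coverings given in Remark 1.4.2 [= [IUTchI] Rmk.
1.2.3 (iii): "`i(G') − n(G') = deg(G'/G)·(i(G) − n(G) − 1) + 1`"]."

This proof-only file (abc-iut cell, sub-DAG row CombGC:Thm1.6(iii)/T16-L16, abc-iut-w5-d174) makes
"formally" kernel-precise over abc-iut-L3-t4's interface (`PSCDatum`; `β : Π/Ker_G ≃ₜ* Π'/Ker_H`,
`unrTransport`).  By abc-iut-L5-t6's `isUnrGroupTheoreticallyVerticial_of_levelwise`
(`PSCUnrVerticialLevelwiseProofs`), group-theoretic verticiality of `β` is the statement that at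
every level `U ⊇ Ker` (open normal) the transport along `β` carries the set of vertex stabilizers
`{U · Π_v^γ}` of the covering `G_U` onto that of `H_{βU}`.  The two printed characterizations enter
as EXPLICIT HYPOTHESES, each APPLIED FUNCTORIALLY, i.e. to every `Π^unr`-covering `G_U` (`U` a
level), and stated in the interface's vocabulary at level `U` (no new definition is introduced; an
elementary abelian quotient `M^unr_{G_U} ↠ Q` is recorded by its kernel `H' ⊆ U`: open,
`closure([U,U]·Ker) ⊆ H' ⊊ U`, `u^l ∈ H'` for `u ∈ U`):

* `hRC` — [CombGC] Rmk. 1.4.2, second display, kept by [IUTchI] Rmk. 1.2.3 (iii) ("if `G' → G` is a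
  finite étale `Π^unr_G`-covering [so `n(G') = n(G)·deg(G'/G)`], then `G' → G` is verticially purely
  totally ramified if and only if `i(G') = deg(G'/G)·(i(G) − 1) + 1`", for Galois `G' → G` of degree a
  positive power of `l`) APPLIED TO THE COVERING `G_U` in place of `G`: the shape of abc-iut-L3-t4's
  typed `VerticialPureRamificationCount` with (`⊤`, `index`, `n(G)`, `i(G)`) replaced by (`U`,
  `relIndex · U`, `n(G_U)`, `i(G_U)`); together with the connectivity bound `i ≤ n + 1` for the graphs
  of `Π^unr`-coverings (displayed, as in abc-iut-L5-t6's `isVerticiallyPurelyTotallyRamified_unrTransport_iff`: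
  Rmk. 1.1.3's rank `n − i + 1` is a natural number);
* `hVC` — [IUTchI] Rmk. 1.2.3 (iv) for `G_U`, read on stabilizers as that Remark prescribes: a
  subgroup `S ⊇ U` is the stabilizer `U · Π_v^γ` of a vertex of `G_U` iff `S` is the normalizer in
  `Π_G` of (the inverse image in `U` of) the kernel of one of the [nontrivial!] quotients
  `M^unr-vert_{G_U} ↠ M^unr_{G_U}[w] ⊗ F_l`, these kernels being the `vertFil U ∩ H'` for `H'` maximal
  among the verticially purely totally ramified kernels as above.

PROVED here: granted `hRC`, `hVC` (and the connectivity bound) for `G` and for `H`, [CombGC] Rmk.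
1.1.3 for both (`AbelianizedGrphRank`, typed row T16-L15) and `Σ_G = Σ_H = {l}`, every verticially
filtration-preserving `β` is group-theoretically verticial
(`isUnrGroupTheoreticallyVerticial_of_isUnrVerticiallyFiltrationPreserving`).  The mechanism is the
transport calculus of `PSCUnrTransportProofs` (lattice, indices, normalizers, `l`-th powers,
`[U,U]·Ker`) and abc-iut-L5-t6's rank transport `grphRank_eq_unrTransport`
(`PSCVerticialRamificationTransportProofs`: `β` induces `M_{G'}/M^vert_{G'} ≅ M_{H'}/M^vert_{H'}`), so
that by Rmk. 1.1.3 + `hRC` the transport preserves verticially purely totally ramified coverings OF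
THE COVERINGS `G_U` (`isVerticiallyPurelyTotallyRamified_level_iff_unrTransport`; L5-t6's
`isVerticiallyPurelyTotallyRamified_unrTransport_iff` is the case `U = Π_G`).  The hypotheses
`hRC`, `hVC` are the cell's residual sub-node statements for this row (GAP-LEDGER), dischargeable
over the covering datum `PSCDatum.restrict` (abc-iut-L3-t4); they are NOT asserted here.  0 defs;
nothing here takes a side on [IUTchIII] Cor. 3.12.
[cite: MochizukiCombGC2007, Thm 1.6(iii) p.14] [cite: Mochizuki2012, IUTchI Rmk 1.2.3(vii) p.43]
-/

noncomputable section

namespace Literature.AnabelianGeometry.SemiGraphs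

namespace PSCDatum

open scoped Pointwise

universe u

variable {P : Type u} [Group P] [TopologicalSpace P] [IsTopologicalGroup P] [CompactSpace P]
  [TotallyDisconnectedSpace P]
variable {P' : Type u} [Group P'] [TopologicalSpace P'] [IsTopologicalGroup P'] [CompactSpace P']
  [TotallyDisconnectedSpace P']
variable (G : PSCDatum P) (H : PSCDatum P') (β : (P ⧸ G.unrKer) ≃ₜ* (P' ⧸ H.unrKer))

/-! ### 1. `β` preserves the verticially purely totally ramified elementary abelian `Π^unr`-quotient coverings -/

section Levelwise

variable {l : ℕ}
variable (hS : G.Sigma = {l}) (hS' : H.Sigma = {l})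
  (hrkG : G.AbelianizedGrphRank) (hrkH : H.AbelianizedGrphRank)
  (hRCG : ∀ (l k : ℕ) (U H' : Subgroup P), G.Sigma = {l} → 0 < k → U.Normal → IsOpen (U : Set P) →
    G.unrKer ≤ U → H' ≤ U → (H'.subgroupOf U).Normal → IsOpen (H' : Set P) → H'.relIndex U = l ^ k →
    G.unrKer ≤ H' →
    (G.nodeCount H' = G.nodeCount U * H'.relIndex U ∧
      (G.IsVerticiallyPurelyTotallyRamified U H' ↔
        (G.vertCount H' : ℤ) = (H'.relIndex U : ℤ) * ((G.vertCount U : ℤ) - 1) + 1)))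
  (hRCH : ∀ (l k : ℕ) (U₁ H₁ : Subgroup P'), H.Sigma = {l} → 0 < k → U₁.Normal →
    IsOpen (U₁ : Set P') → H.unrKer ≤ U₁ → H₁ ≤ U₁ → (H₁.subgroupOf U₁).Normal →
    IsOpen (H₁ : Set P') → H₁.relIndex U₁ = l ^ k → H.unrKer ≤ H₁ →
    (H.nodeCount H₁ = H.nodeCount U₁ * H₁.relIndex U₁ ∧
      (H.IsVerticiallyPurelyTotallyRamified U₁ H₁ ↔
        (H.vertCount H₁ : ℤ) = (H₁.relIndex U₁ : ℤ) * ((H.vertCount U₁ : ℤ) - 1) + 1)))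
  (hiG : ∀ U : Subgroup P, IsOpen (U : Set P) → G.unrKer ≤ U → G.vertCount U ≤ G.nodeCount U + 1)
  (hiH : ∀ U₁ : Subgroup P', IsOpen (U₁ : Set P') → H.unrKer ≤ U₁ →
    H.vertCount U₁ ≤ H.nodeCount U₁ + 1)
  (hβ : G.IsUnrVerticiallyFiltrationPreserving H β)

include hS hS' hrkG hrkH hRCG hRCH hiG hiH hβ

/-- **[CombGC] proof of Thm. 1.6 (iii) / [IUTchI] Rmk. 1.2.3 (vii): a verticially
filtration-preserving `β` PRESERVES verticially purely totally ramified coverings of the coverings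
`G_U`** (`U` a level), among the nontrivial elementary abelian `Π^unr`-quotient coverings
`G_{H'} → G_U`: granted Rmk. 1.1.3 (`AbelianizedGrphRank`), Rmk. 1.4.2 for the coverings `G_U`, `H_{U₁}`
(`hRCG`, `hRCH`) and the connectivity bounds, `G_{H'} → G_U` is verticially purely totally ramified iff
`H_{βH'} → H_{βU}` is — because `β` preserves `[U : H']` (`relIndex_unrTransport`), the ranks
`n + 1 − i` of `M/M^vert` (abc-iut-L5-t6's `grphRank_eq_unrTransport`) and `n(G_{H'}) = [U:H']·n(G_U)`,
and "`i(G') = deg·(i(G_U) − 1) + 1` ⟺ `ρ(G') = deg·ρ(G_U)`" (`vertCount_eq_iff_rank_eq`).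
[cite: Mochizuki2012, IUTchI Rmk 1.2.3(vii) p.43] -/
theorem isVerticiallyPurelyTotallyRamified_level_iff_unrTransport {U H' : Subgroup P}
    (hUn : U.Normal) (hUo : IsOpen (U : Set P)) (hKU : G.unrKer ≤ U)
    (hE : H' ≤ U ∧ H' ≠ U ∧ IsOpen (H' : Set P) ∧ (⁅U, U⁆ ⊔ G.unrKer).topologicalClosure ≤ H' ∧
      ∀ u ∈ U, u ^ l ∈ H') :
    G.IsVerticiallyPurelyTotallyRamified U H' ↔
      H.IsVerticiallyPurelyTotallyRamified (G.unrTransport H β U) (G.unrTransport H β H') := by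
  obtain ⟨hle, hne, hopen, hcl, hpow⟩ := hE
  have hl : l.Prime := G.sigma_prime l (by rw [hS]; exact Set.mem_singleton l)
  have hcomm : ⁅U, U⁆ ≤ H' := (le_sup_left.trans (Subgroup.le_topologicalClosure _)).trans hcl
  have hKH' : G.unrKer ≤ H' := (le_sup_right.trans (Subgroup.le_topologicalClosure _)).trans hcl
  obtain ⟨k, hk, hidx⟩ := relIndex_eq_prime_pow_of_pow_mem hl hne hle hopen hcomm hpow
  -- the `H`-side data
  obtain ⟨hle', hne', hopen', hcl', hpow'⟩ :=
    G.elemAbKernel_unrTransport H β hKU ⟨hle, hne, hopen, hcl, hpow⟩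
  obtain ⟨hU'n, hU'o, hKU'⟩ := G.level_unrTransport H β hUn hUo
  have hcomm' : ⁅G.unrTransport H β U, G.unrTransport H β U⁆ ≤ G.unrTransport H β H' :=
    (le_sup_left.trans (Subgroup.le_topologicalClosure _)).trans hcl'
  have hKH'' : H.unrKer ≤ G.unrTransport H β H' := G.unrKer_le_unrTransport H β H'
  have hidx' : (G.unrTransport H β H').relIndex (G.unrTransport H β U) = l ^ k := by
    rw [G.relIndex_unrTransport H β hKH', hidx]
  obtain ⟨hnG, hiffG⟩ := hRCG l k U H' hS hk hUn hUo hKU hle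
    (subgroupOf_normal_of_commutator_le hcomm) hopen hidx hKH'
  obtain ⟨hnH, hiffH⟩ := hRCH l k _ _ hS' hk hU'n hU'o hKU' hle'
    (subgroupOf_normal_of_commutator_le hcomm') hopen' hidx' hKH''
  rw [hiffG, hiffH, vertCount_eq_iff_rank_eq hnG (hiG U hUo hKU) (hiG H' hopen hKH'),
    vertCount_eq_iff_rank_eq hnH (hiH _ hU'o hKU') (hiH _ hopen' hKH''),
    G.grphRank_eq_unrTransport H β hS hS' hrkG hrkH hβ hUo hKU,
    G.grphRank_eq_unrTransport H β hS hS' hrkG hrkH hβ hopen hKH', G.relIndex_unrTransport H β hKH']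

/-- Transport of MAXIMALITY among the verticially purely totally ramified elementary abelian
`Π^unr`-quotients ([IUTchI] Rmk. 1.2.3 (iv): "the maximal quotients [i.e., relative to the relation
of domination]" — minimal kernels): if `H'` is such a maximal kernel for `G_U`, then `βH'` is one for
`H_{βU}`. [cite: Mochizuki2012, IUTchI Rmk 1.2.3(iv) p.42] -/
theorem vptrMaximal_unrTransport {U H' : Subgroup P} (hUn : U.Normal) (hUo : IsOpen (U : Set P))
    (hKU : G.unrKer ≤ U)
    (hE : H' ≤ U ∧ H' ≠ U ∧ IsOpen (H' : Set P) ∧ (⁅U, U⁆ ⊔ G.unrKer).topologicalClosure ≤ H' ∧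
      ∀ u ∈ U, u ^ l ∈ H')
    (hmax : G.IsVerticiallyPurelyTotallyRamified U H' ∧ ∀ H'' : Subgroup P,
      (H'' ≤ U ∧ H'' ≠ U ∧ IsOpen (H'' : Set P) ∧ (⁅U, U⁆ ⊔ G.unrKer).topologicalClosure ≤ H'' ∧
        ∀ u ∈ U, u ^ l ∈ H'') →
      G.IsVerticiallyPurelyTotallyRamified U H'' → H'' ≤ H' → H'' = H') :
    H.IsVerticiallyPurelyTotallyRamified (G.unrTransport H β U) (G.unrTransport H β H') ∧
      ∀ H₁ : Subgroup P',
        (H₁ ≤ G.unrTransport H β U ∧ H₁ ≠ G.unrTransport H β U ∧ IsOpen (H₁ : Set P') ∧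
          (⁅G.unrTransport H β U, G.unrTransport H β U⁆ ⊔ H.unrKer).topologicalClosure ≤ H₁ ∧
          ∀ u ∈ G.unrTransport H β U, u ^ l ∈ H₁) →
        H.IsVerticiallyPurelyTotallyRamified (G.unrTransport H β U) H₁ →
        H₁ ≤ G.unrTransport H β H' → H₁ = G.unrTransport H β H' := by
  have hKH' : G.unrKer ≤ H' := (le_sup_right.trans (Subgroup.le_topologicalClosure _)).trans hE.2.2.2.1
  refine ⟨(G.isVerticiallyPurelyTotallyRamified_level_iff_unrTransport H β hS hS' hrkG hrkH hRCG hRCH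
    hiG hiH hβ hUn hUo hKU hE).mp hmax.1, fun H₁ hE₁ hV₁ hle => ?_⟩
  obtain ⟨h1, h2, h3, h4, h5, hTT⟩ := G.elemAbKernel_of_unrTransport H β hKU hE₁
  have hE'' : H.unrTransport G β.symm H₁ ≤ U ∧ H.unrTransport G β.symm H₁ ≠ U ∧
      IsOpen (H.unrTransport G β.symm H₁ : Set P) ∧
      (⁅U, U⁆ ⊔ G.unrKer).topologicalClosure ≤ H.unrTransport G β.symm H₁ ∧
      ∀ u ∈ U, u ^ l ∈ H.unrTransport G β.symm H₁ := ⟨h1, h2, h3, h4, h5⟩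
  have hV'' : G.IsVerticiallyPurelyTotallyRamified U (H.unrTransport G β.symm H₁) := by
    rw [G.isVerticiallyPurelyTotallyRamified_level_iff_unrTransport H β hS hS' hrkG hrkH hRCG hRCH
      hiG hiH hβ hUn hUo hKU hE'', hTT]
    exact hV₁
  have hle' : H.unrTransport G β.symm H₁ ≤ H' := by
    rw [← G.unrTransport_le_iff H β hKH', hTT]
    exact hle
  rw [← hTT, hmax.2 _ hE'' hV'' hle']

/-! ### 2. One direction of the level-wise correspondence of vertex stabilizers -/

variable
  (hVCG : ∀ U : Subgroup P, U.Normal → IsOpen (U : Set P) → G.unrKer ≤ U → ∀ S : Subgroup P, U ≤ S →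
    ((∃ (v : G.graph.V) (γ : ConjAct P), S = U ⊔ γ • G.vertGp v) ↔
      ∃ H' : Subgroup P,
        (H' ≤ U ∧ H' ≠ U ∧ IsOpen (H' : Set P) ∧ (⁅U, U⁆ ⊔ G.unrKer).topologicalClosure ≤ H' ∧
          ∀ u ∈ U, u ^ l ∈ H') ∧
        (G.IsVerticiallyPurelyTotallyRamified U H' ∧ ∀ H'' : Subgroup P,
          (H'' ≤ U ∧ H'' ≠ U ∧ IsOpen (H'' : Set P) ∧ (⁅U, U⁆ ⊔ G.unrKer).topologicalClosure ≤ H'' ∧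
            ∀ u ∈ U, u ^ l ∈ H'') →
          G.IsVerticiallyPurelyTotallyRamified U H'' → H'' ≤ H' → H'' = H') ∧
        S = Subgroup.normalizer ((G.vertFil U ⊓ H' : Subgroup P) : Set P)))
  (hVCH : ∀ U₁ : Subgroup P', U₁.Normal → IsOpen (U₁ : Set P') → H.unrKer ≤ U₁ →
    ∀ S₁ : Subgroup P', U₁ ≤ S₁ →
    ((∃ (w : H.graph.V) (δ : ConjAct P'), S₁ = U₁ ⊔ δ • H.vertGp w) ↔
      ∃ H₁ : Subgroup P',
        (H₁ ≤ U₁ ∧ H₁ ≠ U₁ ∧ IsOpen (H₁ : Set P') ∧ (⁅U₁, U₁⁆ ⊔ H.unrKer).topologicalClosure ≤ H₁ ∧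
          ∀ u ∈ U₁, u ^ l ∈ H₁) ∧
        (H.IsVerticiallyPurelyTotallyRamified U₁ H₁ ∧ ∀ H₂ : Subgroup P',
          (H₂ ≤ U₁ ∧ H₂ ≠ U₁ ∧ IsOpen (H₂ : Set P') ∧ (⁅U₁, U₁⁆ ⊔ H.unrKer).topologicalClosure ≤ H₂ ∧
            ∀ u ∈ U₁, u ^ l ∈ H₂) →
          H.IsVerticiallyPurelyTotallyRamified U₁ H₂ → H₂ ≤ H₁ → H₂ = H₁) ∧
        S₁ = Subgroup.normalizer ((H.vertFil U₁ ⊓ H₁ : Subgroup P') : Set P')))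

include hVCG hVCH

/-- **The stabilizer of a vertex of `G_U` is carried by `β` to the stabilizer of a vertex of `H_{βU}`**
(one direction of the level-wise correspondence to which abc-iut-L5-t6 reduced Thm. 1.6 (iii)), granted
the functorial vertex characterization of [IUTchI] Rmk. 1.2.3 (iv) for `G` and `H` (`hVCG`, `hVCH`) and
the inputs of `isVerticiallyPurelyTotallyRamified_iff_unrTransport`: the stabilizer is the normalizer of
a characterized kernel, and kernels, `vertFil`, `∩`, maximality and normalizers are all carried by `β`.
[cite: Mochizuki2012, IUTchI Rmk 1.2.3(vii) p.43] -/
theorem exists_unrTransport_eq_vertexStabilizer {U S : Subgroup P} (hUn : U.Normal)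
    (hUo : IsOpen (U : Set P)) (hKU : G.unrKer ≤ U) (hUS : U ≤ S)
    (hSv : ∃ (v : G.graph.V) (γ : ConjAct P), S = U ⊔ γ • G.vertGp v) :
    ∃ (w : H.graph.V) (δ : ConjAct P'),
      G.unrTransport H β S = G.unrTransport H β U ⊔ δ • H.vertGp w := by
  obtain ⟨H', hE, hmax, hSN⟩ := (hVCG U hUn hUo hKU S hUS).mp hSv
  have hKH' : G.unrKer ≤ H' := (le_sup_right.trans (Subgroup.le_topologicalClosure _)).trans hE.2.2.2.1
  have hKV : G.unrKer ≤ G.vertFil U := G.unrKer_le_vertFil hKU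
  obtain ⟨hU'n, hU'o, hKU'⟩ := G.level_unrTransport H β hUn hUo
  refine (hVCH _ hU'n hU'o hKU' _ (G.unrTransport_mono H β hUS)).mpr
    ⟨G.unrTransport H β H', G.elemAbKernel_unrTransport H β hKU hE,
      G.vptrMaximal_unrTransport H β hS hS' hrkG hrkH hRCG hRCH hiG hiH hβ hUn hUo hKU hE hmax, ?_⟩
  rw [hSN, G.unrTransport_normalizer H β (le_inf hKV hKH'), G.unrTransport_inf H β hKV,
    hβ U hUo hKU]

end Levelwise

/-! ### 3. Theorem 1.6 (iii), necessity -/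

/-- **[CombGC] Theorem 1.6 (iii), necessity ("verticially filtration-preserving ⟹ group-theoretically
verticial"), assembled as [IUTchI] Rmk. 1.2.3 (vii) prescribes** ("follows formally from the
characterization of unramified verticial subgroups given in Remark 1.4.3 and the characterization of
verticially purely totally ramified finite étale coverings given in Remark 1.4.2"): for sturdy `G`,
`H` with `Σ_G = Σ_H = {l}` on profinite `Π_G`, `Π_H`, GRANTED — as explicit hypotheses, each applied
functorially to the `Π^unr`-coverings `G_U`, `H_{U₁}` (`U`, `U₁` levels) — (`hRCG`/`hRCH`) the
numerical criterion of [IUTchI] Rmk. 1.2.3 (iii) in its rank form via Rmk. 1.1.3, (`hVCG`/`hVCH`) the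
vertex characterization of [IUTchI] Rmk. 1.2.3 (iv) read on stabilizers, and (`hrkG`/`hrkH`) Rmk.
1.1.3 (`AbelianizedGrphRank`): every verticially filtration-preserving `β : Π^unr_G ⥲ Π^unr_H` is
group-theoretically verticial (Def. 1.4 (iv)).  Route: abc-iut-L5-t6's reduction
`isUnrGroupTheoreticallyVerticial_of_levelwise` + `exists_unrTransport_eq_vertexStabilizer` for `β`
and for `β⁻¹`.  The hypotheses are the row's residual sub-node statements, not asserted here.
[cite: MochizukiCombGC2007, Thm 1.6(iii) p.14] [cite: Mochizuki2012, IUTchI Rmk 1.2.3(vii) p.43] -/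
theorem isUnrGroupTheoreticallyVerticial_of_isUnrVerticiallyFiltrationPreserving
    (hG : G.IsSturdy) (hH : H.IsSturdy) {l : ℕ} (hSG : G.Sigma = {l}) (hSH : H.Sigma = {l})
    (hrkG : G.AbelianizedGrphRank) (hrkH : H.AbelianizedGrphRank)
    (hRCG : ∀ (l k : ℕ) (U H' : Subgroup P), G.Sigma = {l} → 0 < k → U.Normal → IsOpen (U : Set P) →
      G.unrKer ≤ U → H' ≤ U → (H'.subgroupOf U).Normal → IsOpen (H' : Set P) →
      H'.relIndex U = l ^ k → G.unrKer ≤ H' →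
      (G.nodeCount H' = G.nodeCount U * H'.relIndex U ∧
        (G.IsVerticiallyPurelyTotallyRamified U H' ↔
          (G.vertCount H' : ℤ) = (H'.relIndex U : ℤ) * ((G.vertCount U : ℤ) - 1) + 1)))
    (hRCH : ∀ (l k : ℕ) (U₁ H₁ : Subgroup P'), H.Sigma = {l} → 0 < k → U₁.Normal →
      IsOpen (U₁ : Set P') → H.unrKer ≤ U₁ → H₁ ≤ U₁ → (H₁.subgroupOf U₁).Normal →
      IsOpen (H₁ : Set P') → H₁.relIndex U₁ = l ^ k → H.unrKer ≤ H₁ →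
      (H.nodeCount H₁ = H.nodeCount U₁ * H₁.relIndex U₁ ∧
        (H.IsVerticiallyPurelyTotallyRamified U₁ H₁ ↔
          (H.vertCount H₁ : ℤ) = (H₁.relIndex U₁ : ℤ) * ((H.vertCount U₁ : ℤ) - 1) + 1)))
    (hiG : ∀ U : Subgroup P, IsOpen (U : Set P) → G.unrKer ≤ U → G.vertCount U ≤ G.nodeCount U + 1)
    (hiH : ∀ U₁ : Subgroup P', IsOpen (U₁ : Set P') → H.unrKer ≤ U₁ →
      H.vertCount U₁ ≤ H.nodeCount U₁ + 1)
    (hVCG : G.IsSturdy → ∀ l : ℕ, G.Sigma = {l} → ∀ U : Subgroup P, U.Normal → IsOpen (U : Set P) →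
      G.unrKer ≤ U → ∀ S : Subgroup P, U ≤ S →
      ((∃ (v : G.graph.V) (γ : ConjAct P), S = U ⊔ γ • G.vertGp v) ↔
        ∃ H' : Subgroup P,
          (H' ≤ U ∧ H' ≠ U ∧ IsOpen (H' : Set P) ∧ (⁅U, U⁆ ⊔ G.unrKer).topologicalClosure ≤ H' ∧
            ∀ u ∈ U, u ^ l ∈ H') ∧
          (G.IsVerticiallyPurelyTotallyRamified U H' ∧ ∀ H'' : Subgroup P,
            (H'' ≤ U ∧ H'' ≠ U ∧ IsOpen (H'' : Set P) ∧
                (⁅U, U⁆ ⊔ G.unrKer).topologicalClosure ≤ H'' ∧ ∀ u ∈ U, u ^ l ∈ H'') →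
            G.IsVerticiallyPurelyTotallyRamified U H'' → H'' ≤ H' → H'' = H') ∧
          S = Subgroup.normalizer ((G.vertFil U ⊓ H' : Subgroup P) : Set P)))
    (hVCH : H.IsSturdy → ∀ l : ℕ, H.Sigma = {l} → ∀ U₁ : Subgroup P', U₁.Normal →
      IsOpen (U₁ : Set P') → H.unrKer ≤ U₁ → ∀ S₁ : Subgroup P', U₁ ≤ S₁ →
      ((∃ (w : H.graph.V) (δ : ConjAct P'), S₁ = U₁ ⊔ δ • H.vertGp w) ↔
        ∃ H₁ : Subgroup P',
          (H₁ ≤ U₁ ∧ H₁ ≠ U₁ ∧ IsOpen (H₁ : Set P') ∧ (⁅U₁, U₁⁆ ⊔ H.unrKer).topologicalClosure ≤ H₁ ∧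
            ∀ u ∈ U₁, u ^ l ∈ H₁) ∧
          (H.IsVerticiallyPurelyTotallyRamified U₁ H₁ ∧ ∀ H₂ : Subgroup P',
            (H₂ ≤ U₁ ∧ H₂ ≠ U₁ ∧ IsOpen (H₂ : Set P') ∧
                (⁅U₁, U₁⁆ ⊔ H.unrKer).topologicalClosure ≤ H₂ ∧ ∀ u ∈ U₁, u ^ l ∈ H₂) →
            H.IsVerticiallyPurelyTotallyRamified U₁ H₂ → H₂ ≤ H₁ → H₂ = H₁) ∧
          S₁ = Subgroup.normalizer ((H.vertFil U₁ ⊓ H₁ : Subgroup P') : Set P')))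
    (hβ : G.IsUnrVerticiallyFiltrationPreserving H β) :
    G.IsUnrGroupTheoreticallyVerticial H β := by
  have hβ' : H.IsUnrVerticiallyFiltrationPreserving G β.symm :=
    IsUnrVerticiallyFiltrationPreserving.symm G H β hβ
  refine G.isUnrGroupTheoreticallyVerticial_of_levelwise H β fun U hUn hUo hKU S hUS => ⟨?_, ?_⟩
  · exact G.exists_unrTransport_eq_vertexStabilizer H β hSG hSH hrkG hrkH hRCG hRCH hiG hiH hβ
      (hVCG hG l hSG) (hVCH hH l hSH) hUn hUo hKU hUS
  · intro hS'
    obtain ⟨hU'n, hU'o, hKU'⟩ := G.level_unrTransport H β hUn hUo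
    have h := H.exists_unrTransport_eq_vertexStabilizer G β.symm hSH hSG hrkH hrkG hRCH hRCG hiH hiG
      hβ' (hVCH hH l hSH) (hVCG hG l hSG) hU'n hU'o hKU' (G.unrTransport_mono H β hUS) hS'
    rwa [G.unrTransport_symm_unrTransport H β (hKU.trans hUS),
      G.unrTransport_symm_unrTransport H β hKU] at h

/-- **[CombGC] Theorem 1.6 (iii) for `(G, H, β)` — the typed row predicate
`UnrVerticiallyFiltrationPreservingIffVerticial` — modulo the residual level-wise statements**:
necessity from `isUnrGroupTheoreticallyVerticial_of_isUnrVerticiallyFiltrationPreserving`, sufficiency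
("immediate", [IUTchI] Rmk. 1.2.3 (vii)) from abc-iut-L5-t6's
`Rmk123.isUnrVerticiallyFiltrationPreserving_of_isUnrGroupTheoreticallyVerticial`.
[cite: MochizukiCombGC2007, Thm 1.6(iii) p.13] -/
theorem unrVerticiallyFiltrationPreservingIffVerticial_of_levelwise {l : ℕ} (hSG : G.Sigma = {l})
    (hSH : H.Sigma = {l}) (hrkG : G.AbelianizedGrphRank) (hrkH : H.AbelianizedGrphRank)
    (hRCG : ∀ (l k : ℕ) (U H' : Subgroup P), G.Sigma = {l} → 0 < k → U.Normal → IsOpen (U : Set P) →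
      G.unrKer ≤ U → H' ≤ U → (H'.subgroupOf U).Normal → IsOpen (H' : Set P) →
      H'.relIndex U = l ^ k → G.unrKer ≤ H' →
      (G.nodeCount H' = G.nodeCount U * H'.relIndex U ∧
        (G.IsVerticiallyPurelyTotallyRamified U H' ↔
          (G.vertCount H' : ℤ) = (H'.relIndex U : ℤ) * ((G.vertCount U : ℤ) - 1) + 1)))
    (hRCH : ∀ (l k : ℕ) (U₁ H₁ : Subgroup P'), H.Sigma = {l} → 0 < k → U₁.Normal →
      IsOpen (U₁ : Set P') → H.unrKer ≤ U₁ → H₁ ≤ U₁ → (H₁.subgroupOf U₁).Normal →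
      IsOpen (H₁ : Set P') → H₁.relIndex U₁ = l ^ k → H.unrKer ≤ H₁ →
      (H.nodeCount H₁ = H.nodeCount U₁ * H₁.relIndex U₁ ∧
        (H.IsVerticiallyPurelyTotallyRamified U₁ H₁ ↔
          (H.vertCount H₁ : ℤ) = (H₁.relIndex U₁ : ℤ) * ((H.vertCount U₁ : ℤ) - 1) + 1)))
    (hiG : ∀ U : Subgroup P, IsOpen (U : Set P) → G.unrKer ≤ U → G.vertCount U ≤ G.nodeCount U + 1)
    (hiH : ∀ U₁ : Subgroup P', IsOpen (U₁ : Set P') → H.unrKer ≤ U₁ →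
      H.vertCount U₁ ≤ H.nodeCount U₁ + 1)
    (hVCG : G.IsSturdy → ∀ l : ℕ, G.Sigma = {l} → ∀ U : Subgroup P, U.Normal → IsOpen (U : Set P) →
      G.unrKer ≤ U → ∀ S : Subgroup P, U ≤ S →
      ((∃ (v : G.graph.V) (γ : ConjAct P), S = U ⊔ γ • G.vertGp v) ↔
        ∃ H' : Subgroup P,
          (H' ≤ U ∧ H' ≠ U ∧ IsOpen (H' : Set P) ∧ (⁅U, U⁆ ⊔ G.unrKer).topologicalClosure ≤ H' ∧
            ∀ u ∈ U, u ^ l ∈ H') ∧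
          (G.IsVerticiallyPurelyTotallyRamified U H' ∧ ∀ H'' : Subgroup P,
            (H'' ≤ U ∧ H'' ≠ U ∧ IsOpen (H'' : Set P) ∧
                (⁅U, U⁆ ⊔ G.unrKer).topologicalClosure ≤ H'' ∧ ∀ u ∈ U, u ^ l ∈ H'') →
            G.IsVerticiallyPurelyTotallyRamified U H'' → H'' ≤ H' → H'' = H') ∧
          S = Subgroup.normalizer ((G.vertFil U ⊓ H' : Subgroup P) : Set P)))
    (hVCH : H.IsSturdy → ∀ l : ℕ, H.Sigma = {l} → ∀ U₁ : Subgroup P', U₁.Normal →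
      IsOpen (U₁ : Set P') → H.unrKer ≤ U₁ → ∀ S₁ : Subgroup P', U₁ ≤ S₁ →
      ((∃ (w : H.graph.V) (δ : ConjAct P'), S₁ = U₁ ⊔ δ • H.vertGp w) ↔
        ∃ H₁ : Subgroup P',
          (H₁ ≤ U₁ ∧ H₁ ≠ U₁ ∧ IsOpen (H₁ : Set P') ∧ (⁅U₁, U₁⁆ ⊔ H.unrKer).topologicalClosure ≤ H₁ ∧
            ∀ u ∈ U₁, u ^ l ∈ H₁) ∧
          (H.IsVerticiallyPurelyTotallyRamified U₁ H₁ ∧ ∀ H₂ : Subgroup P',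
            (H₂ ≤ U₁ ∧ H₂ ≠ U₁ ∧ IsOpen (H₂ : Set P') ∧
                (⁅U₁, U₁⁆ ⊔ H.unrKer).topologicalClosure ≤ H₂ ∧ ∀ u ∈ U₁, u ^ l ∈ H₂) →
            H.IsVerticiallyPurelyTotallyRamified U₁ H₂ → H₂ ≤ H₁ → H₂ = H₁) ∧
          S₁ = Subgroup.normalizer ((H.vertFil U₁ ⊓ H₁ : Subgroup P') : Set P'))) :
    G.UnrVerticiallyFiltrationPreservingIffVerticial H β := fun hG hH =>
  ⟨fun hβ => G.isUnrGroupTheoreticallyVerticial_of_isUnrVerticiallyFiltrationPreserving H β hG hH hSG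
      hSH hrkG hrkH hRCG hRCH hiG hiH hVCG hVCH hβ,
    fun h => Literature.IUT.HodgeTheaters.Rmk123.isUnrVerticiallyFiltrationPreserving_of_isUnrGroupTheoreticallyVerticial
      G H β h⟩

end PSCDatum

end Literature.AnabelianGeometry.SemiGraphs

end
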